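import Literature.MathematicalPhysics.QuantumLattice.KaplanHorschVonDerLindenU1System
import Literature.MathematicalPhysics.QuantumLattice.KomaTasakiThermalFiniteVolumeFieldBound
import Literature.MathematicalPhysics.QuantumLattice.KomaPiFluxSpontaneousOrder
import Literature.MathematicalPhysics.QuantumLattice.KomaPiFluxZ2System
import HarnessLib

/-!
# Koma–Tasaki in ONE finite volume for Koma's `π`-flux BCS lattice-fermion model: a certified pairing
# long-range-order number on a torus gives an explicit floor on the sourced pairing amplitude on that torus,
# at `T = 0` (KT93 Theorem 7.1 / Kaplan–Horsch–von der Linden) and at `T > 0` (KT93 Theorem 2.1)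

Koma–Tasaki 1993 (`KomaTasaki1993`) p. 211: their theorems "can be applied to the electron pair condensation problems
in lattice electron systems".  This file reads the tree's two ONE-VOLUME forms of their theorems through the
dictionaries of Koma's `π`-flux BCS model with the Coulomb term (T. Koma, arXiv:2201.13135, `Koma2022`; Lieb frame,
`H = hamiltonianC κ U g g' 0 B = H(κ,U;g,g';0;B)` on `Λ = (ℤ/Lℤ)^{d+1}`, order parameter `O = Σ_xΓ²_x = orderParameter`):

* `T = 0` (`ground_sourcedPairing_ge_finiteVolume`): a number `s > 0` with `s² ≤ groundLroSq H(…;0)`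
  (`= |Λ|⁻²Σ_{x,y} Re ω_GS(Γ¹_xΓ¹_y)`, the ground-state pairing long-range order on THIS torus) gives, for every `B > 0`
  and EVERY normalised ground state `Φ_B` of `H(…;B) = H(…;0) - B·O`,
  **`|Λ|⁻¹ Re⟨Φ_B, OΦ_B⟩ ≥ s - r²h̄/(μ²B|Λ|²)`**, `μ = s/2`, `r = 2(d+1)+1`, `h̄ = hbarConst d κ U g g'`
  — KT93 (7.10) through `KomaTasaki.U1System.kaplanHorschVonDerLinden_order_density_of_isLROEigenstate` over the
  tree's `KomaPiFlux.ktSystem` and the long-range-ordered ground eigenstate in a particle-number sector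
  (`exists_groundState_eigenvector_of_groundLroSq`, `ktSystem_isLROEigenstate`); tracial form `…_groundStateFunctional`.
  No size condition, no window on the couplings, no limit; the `√2`-improved LIMIT form is `spontaneousOrder_of_groundLroSq`.
* `T > 0` (`thermal_sourcedPairing_ge_finiteVolume`): a number `s ≤ lroSq β H(…;0)` gives, for every `B > 0`, `t ≥ 0`,
  `ℓ > 0`, `K ≥ 1`, **`|Λ|⁻¹ Re⟨O⟩_{β,H(…;B)} ≥ √(s - E) - t`**, `E = 32(2rh̄)²ō²K²/ℓ² + 2ō²/K + 2ō²e^{βℓ}e^{-β|Λ|Bt}`,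
  `ō = 2` — KT93 (5.3) + (4.6) through `KomaTasaki.Z2System.sqrt_sub_le_magnetisation_add` over `KomaPiFlux.z2System`.

Theorems only, no named facts, no sorry; `attribute [local instance] LiebCutRP.decEqTorus` as in every file of the
`KomaPiFlux` series (the statements must elaborate with the series' `DecidableEq` instance on the torus).

## References
* [KomaTasaki1993] T. Koma, H. Tasaki, Commun. Math. Phys. **158** (1993) 191–214, Theorem 2.1, (4.6), (5.3); Theorem 7.1,
  (7.4)–(7.10), i'); p. 211.
* [KomaTasaki1994] T. Koma, H. Tasaki, J. Stat. Phys. **76** (1994) 745–803, §2.3, Theorem 2.2, §3.3–3.4.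
* [Koma2022] T. Koma, arXiv:2201.13135, (2.4)–(2.6), (2.10)–(2.15), Theorem 2.1.
* [KaplanHorschVonDerLinden1989] T. A. Kaplan, P. Horsch, W. von der Linden, J. Phys. Soc. Jpn. **58** (1989) 3894.
-/

noncomputable section

namespace Literature.MathematicalPhysics.QuantumLattice

open _root_.Matrix Finset Filter Topology HubbardWave0 PairHopRP FermionTorus LiebCutRP WithLp
open Literature.Probability.LatticeModels
open scoped Matrix.Norms.L2Operator InnerProductSpace ComplexConjugate ComplexOrder

namespace KomaPiFlux

attribute [local instance] LiebCutRP.decEqTorus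

variable {d : ℕ}

open KT

/-! ### §1. `T = 0`: Kaplan–Horsch–von der Linden / KT93 (7.10) on one torus -/

/-- **KOMA'S `π`-FLUX BCS MODEL, ONE TORUS, `T = 0`: certified ground-state pairing long-range order ⟹ explicit floor
on the sourced pairing amplitude of EVERY ground state.**  On `Λ = (ℤ/Lℤ)^{d+1}`, `H = hamiltonianC κ U g g' 0 0`
(any real `κ, U, g, g'`): if `s > 0` and `s² ≤ groundLroSq H`, then for every `B > 0` and every unit ground state
`Φ_B` of `hamiltonianC κ U g g' 0 B = H - B·Σ_xΓ²_x`,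
**`|Λ|⁻¹ Re Φ_B†(Σ_xΓ²_x)Φ_B ≥ s - (2(d+1)+1)² h̄ / ((s/2)² B |Λ|²)`**, `h̄ = hbarConst d κ U g g'`.
Proof: a unit ground state `Φ` of `H` in a particle-number sector with `Re Φ†(Σ_xΓ¹_x)²Φ ≥ s²|Λ|²`
(`exists_groundState_eigenvector_of_groundLroSq`) is an `IsLROEigenstate` of `ktSystem` with `μ = s/2`
(`ktSystem_isLROEigenstate`; `μ ≤ 1` by `U1System.mu_le_one_of_re_inner_order_sq_ge`), and
`U1System.kaplanHorschVonDerLinden_order_density_of_isLROEigenstate` (odd moments vanish by the `U(1)` charge, KT93 i')).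
[cite: KomaTasaki1993, Theorem 7.1 (7.10), i'); p. 211] [cite: KomaTasaki1994, Theorem 2.2, §2.3 iv), §3.3]
[cite: Koma2022, (2.13)–(2.15)] [cite: KaplanHorschVonDerLinden1989, main theorem] -/
theorem ground_sourcedPairing_ge_finiteVolume (L : ℕ) [NeZero L] (κ U g g' : ℝ) {s : ℝ} (hs : 0 < s)
    (hlro : s ^ 2 ≤ groundLroSq (hamiltonianC κ U g g' (fun (_ _ : FermionTorus (d + 1) L) => (0 : ℝ)) 0))
    {B : ℝ} (hB : 0 < B) {ΦB : Idx d L → ℂ} (hΦB : star ΦB ⬝ᵥ ΦB = 1)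
    (hHB : hamiltonianC κ U g g' (fun (_ _ : FermionTorus (d + 1) L) => (0 : ℝ)) B *ᵥ ΦB =
      ((hamiltonianC κ U g g' (fun (_ _ : FermionTorus (d + 1) L) => (0 : ℝ)) B).groundEnergy : ℂ) • ΦB) :
    s - ((2 * (d + 1) + 1 : ℕ) : ℝ) ^ 2 * hbarConst d κ U g g' / (s / 2) ^ 2 /
        (B * (Fintype.card (FermionTorus (d + 1) L) : ℝ) ^ 2) ≤
      (star ΦB ⬝ᵥ (orderParameter *ᵥ ΦB)).re / (Fintype.card (FermionTorus (d + 1) L) : ℝ) := by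
  set μ : ℝ := s / 2 with hμ_def
  have hμ : 0 < μ := by positivity
  have hμs : μ * 2 = s := by rw [hμ_def, div_mul_cancel₀ _ two_ne_zero]
  -- the long-range-ordered ground eigenstate in a particle-number sector
  set H₀ := hamiltonianC κ U g g' (fun (_ _ : FermionTorus (d + 1) L) => (0 : ℝ)) 0 with hH₀
  have hH₀herm : H₀.IsHermitian := hamiltonianC_isHermitian κ U g g' _ 0
  obtain ⟨Φ, hΦ, hHΦ, ⟨ν, hNΦ⟩, hlroΦ⟩ := exists_groundState_eigenvector_of_groundLroSq hH₀herm
    (PairHopRP.commute_totalNumber_hamiltonianC_zero (G d L) (piFluxAmpl κ) U g g') hlro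
  have hlro' : (μ * 2 * (Fintype.card (FermionTorus (d + 1) L) : ℝ)) ^ 2 ≤
      (star Φ ⬝ᵥ ((∑ x : FermionTorus (d + 1) L, gammaOne x) *ᵥ
        ((∑ x : FermionTorus (d + 1) L, gammaOne x) *ᵥ Φ))).re := by
    rw [hμs, mul_pow]
    exact hlroΦ
  -- `μ ≤ 1` (from the `O^{(2)} = Σ_xΓ¹_x` form of the long-range order) and hypothesis iv)
  have hlro₁ : (μ * (ktSystem (d := d) (L := L) κ U g g').obar * Fintype.card (FermionTorus (d + 1) L)) ^ 2 ≤
      (⟪(toLp 2 Φ : EuclideanSpace ℂ (Idx d L)), (ktSystem (d := d) (L := L) κ U g g').order 1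
        ((ktSystem (d := d) (L := L) κ U g g').order 1 (toLp 2 Φ))⟫_ℂ).re := by
    rw [ktSystem_obar, ktSystem_order_one, toEuclideanCLM_toLp, toEuclideanCLM_toLp, inner_toLp_toLp_eq_dotProduct]
    exact hlro'
  have hμ1 : μ ≤ 1 := (ktSystem (d := d) (L := L) κ U g g').mu_le_one_of_re_inner_order_sq_ge 1
    (norm_toLp_eq_one_of_dotProduct hΦ) hlro₁
  have hLRO : KomaTasaki.IsLROEigenstate (ktSystem (d := d) (L := L) κ U g g') (toLp 2 Φ) H₀.groundEnergy μ :=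
    ktSystem_isLROEigenstate κ U g g' hΦ hHΦ hNΦ hμ hμ1 hlro'
  -- the ground-state hypotheses
  have hground : ∀ ψ : EuclideanSpace ℂ (Idx d L), ‖ψ‖ = 1 →
      H₀.groundEnergy ≤ (⟪ψ, (ktSystem (d := d) (L := L) κ U g g').hamiltonian ψ⟫_ℂ).re := by
    intro ψ hψ
    rw [ktSystem_hamiltonian]
    exact Matrix.groundEnergy_le_re_inner_toEuclideanCLM' hH₀herm ψ hψ
  set HB := hamiltonianC κ U g g' (fun (_ _ : FermionTorus (d + 1) L) => (0 : ℝ)) B with hHB_def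
  have hHBherm : HB.IsHermitian := hamiltonianC_isHermitian κ U g g' _ B
  have hfield : (ktSystem (d := d) (L := L) κ U g g').hamiltonian -
      (B : ℂ) • (ktSystem (d := d) (L := L) κ U g g').order 0 = toEuclideanCLM (n := Idx d L) (𝕜 := ℂ) HB := by
    rw [ktSystem_field]
  have hΦB1 : ‖(toLp 2 ΦB : EuclideanSpace ℂ (Idx d L))‖ = 1 := norm_toLp_eq_one_of_dotProduct hΦB
  have hmin : ∀ ψ : EuclideanSpace ℂ (Idx d L), ‖ψ‖ = 1 →
      (⟪(toLp 2 ΦB : EuclideanSpace ℂ (Idx d L)), ((ktSystem (d := d) (L := L) κ U g g').hamiltonian -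
          (B : ℂ) • (ktSystem (d := d) (L := L) κ U g g').order 0) (toLp 2 ΦB)⟫_ℂ).re ≤
        (⟪ψ, ((ktSystem (d := d) (L := L) κ U g g').hamiltonian -
          (B : ℂ) • (ktSystem (d := d) (L := L) κ U g g').order 0) ψ⟫_ℂ).re := by
    intro ψ hψ
    rw [hfield]
    exact Matrix.re_inner_toEuclideanCLM_le_of_groundState hHBherm hΦB hHB ψ hψ
  -- KT93 (7.10)
  have h := (ktSystem (d := d) (L := L) κ U g g').kaplanHorschVonDerLinden_order_density_of_isLROEigenstate hLRO
    hground hB hΦB1 hmin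
  have eB : (⟪(toLp 2 ΦB : EuclideanSpace ℂ (Idx d L)),
      (ktSystem (d := d) (L := L) κ U g g').order 0 (toLp 2 ΦB)⟫_ℂ).re = (star ΦB ⬝ᵥ (orderParameter *ᵥ ΦB)).re := by
    rw [ktSystem_order_zero, toEuclideanCLM_toLp, inner_toLp_toLp_eq_dotProduct]
  rw [eB, ktSystem_obar, ktSystem_hbar, ktSystem_r, hμs] at h
  exact h

/-- **The same floor for the tracial sourced ground state** (uniform mixture of the ground states of `H - B·O`,
Koma's `ω^{(Λ)}_{0,B}` at `β → ∞`): `|Λ|⁻¹ Re ω_{GS,B}(Σ_xΓ²_x) ≥ s - (2(d+1)+1)²h̄/((s/2)²B|Λ|²)`.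
[cite: KomaTasaki1993, Theorem 7.1 (7.10), (7.5)] [cite: Koma2022, (2.13)] -/
theorem ground_sourcedPairing_ge_finiteVolume_groundStateFunctional (L : ℕ) [NeZero L] (κ U g g' : ℝ) {s : ℝ}
    (hs : 0 < s)
    (hlro : s ^ 2 ≤ groundLroSq (hamiltonianC κ U g g' (fun (_ _ : FermionTorus (d + 1) L) => (0 : ℝ)) 0))
    {B : ℝ} (hB : 0 < B) :
    s - ((2 * (d + 1) + 1 : ℕ) : ℝ) ^ 2 * hbarConst d κ U g g' / (s / 2) ^ 2 /
        (B * (Fintype.card (FermionTorus (d + 1) L) : ℝ) ^ 2) ≤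
      ((hamiltonianC κ U g g' (fun (_ _ : FermionTorus (d + 1) L) => (0 : ℝ)) B).groundStateFunctional
          orderParameter).re / (Fintype.card (FermionTorus (d + 1) L) : ℝ) := by
  set HB := hamiltonianC κ U g g' (fun (_ _ : FermionTorus (d + 1) L) => (0 : ℝ)) B with hHB_def
  have hHBherm : HB.IsHermitian := hamiltonianC_isHermitian κ U g g' _ B
  -- a ground state of `H_B` minimising the order parameter among the mixture
  obtain ⟨Φ, hΦ, hHΦ, -, hO⟩ :=
    Matrix.exists_groundState_eigenvector_re_ge hHBherm hHBherm rfl (-orderParameter)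
  have h := ground_sourcedPairing_ge_finiteVolume L κ U g g' hs hlro hB hΦ hHΦ
  rw [map_neg, Complex.neg_re, neg_mulVec, dotProduct_neg, Complex.neg_re, neg_le_neg_iff] at hO
  have hcard : (0 : ℝ) < (Fintype.card (FermionTorus (d + 1) L) : ℝ) := by exact_mod_cast Fintype.card_pos
  exact h.trans (div_le_div_of_nonneg_right hO hcard.le)

/-! ### §2. `T > 0`: KT93 Theorem 2.1 ((5.3) + (4.6)) on one torus -/


/-- **KOMA'S `π`-FLUX BCS MODEL, ONE TORUS, `T > 0`: certified pairing long-range order ⟹ floor on the sourced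
pairing amplitude.**  On `Λ = (ℤ/Lℤ)^{d+1}`, `H = hamiltonianC κ U g g' 0 0 = H(κ,U;g,g';0;0)` (Lieb frame), order
parameter `O = Σ_xΓ²_x` (`orderParameter`): if `s ≤ lroSq β H` (`= |Λ|⁻² Σ_{x,y} Re⟨Γ¹_xΓ¹_y⟩_β`, which equals the
`Γ²` moment by the `η`-rotation symmetry), then for every `B > 0`, `t ≥ 0`, `ℓ > 0`, `K ≥ 1`,
`|Λ|⁻¹ Re⟨Σ_xΓ²_x⟩_{β, H(κ,U;g,g';0;B)} ≥ √(s - E) - t`,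
`E = 32(2rh̄)²ō²K²/ℓ² + 2ō²/K + 2ō²e^{βℓ}e^{-β|Λ|Bt}` with `r = 2(d+1)+1`, `h̄ = hbarConst d κ U g g'`, `ō = 2`.
[cite: KomaTasaki1993, Theorem 2.1, (4.6), (5.3); p. 211] [cite: Koma2022, (2.10)–(2.12), Theorem 2.1] -/
theorem thermal_sourcedPairing_ge_finiteVolume (L : ℕ) [NeZero L] (κ U g g' : ℝ) {β : ℝ} (hβ : 0 < β) {B : ℝ}
    (hB : 0 < B) {t : ℝ} (ht : 0 ≤ t) {ℓ : ℝ} (hℓ : 0 < ℓ) {K : ℕ} (hK : 1 ≤ K) {s : ℝ}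
    (hcert : s ≤ lroSq β (hamiltonianC κ U g g' (fun (_ _ : FermionTorus (d + 1) L) => (0 : ℝ)) 0)) :
    Real.sqrt (s - (32 * (2 * ((2 * (d + 1) + 1 : ℕ) : ℝ) * hbarConst d κ U g g') ^ 2 * (2 : ℝ) ^ 2 * K ^ 2 / ℓ ^ 2 +
        2 * (2 : ℝ) ^ 2 / K +
        2 * (2 : ℝ) ^ 2 * Real.exp (β * ℓ) *
          Real.exp (-(β * Fintype.card (FermionTorus (d + 1) L) * (B * t))))) - t ≤
      (Fintype.card (FermionTorus (d + 1) L) : ℝ)⁻¹ *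
        (gibbsState β (hamiltonianC κ U g g' (fun (_ _ : FermionTorus (d + 1) L) => (0 : ℝ)) B)
          orderParameter).re := by
  have hc : s ≤ (z2System (d := d) (L := L) κ U g g').moment β 1 := by rwa [z2System_moment_one]
  have h := (z2System (d := d) (L := L) κ U g g').sqrt_sub_le_magnetisation_add Fintype.card_pos hβ hB ht hℓ hK hc
  rwa [z2System_magnetisation] at h


end KomaPiFlux

end Literature.MathematicalPhysics.QuantumLattice
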